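import Mathlib.Analysis.InnerProductSpace.LaxMilgram
import Mathlib.Analysis.InnerProductSpace.Adjoint
import Literature.Analysis.Calculus.KernelTangentFamily
import HarnessLib

/-!
# Right inverses of adjoints from a coercivity estimate (the operator frame of
# Chruściel–Delay 2003, Thm. 3.6 / Thm. 3.9 / Cor. 5.11)

The functional-analytic skeleton of the weighted local surjectivity theory of underdetermined
elliptic operators (Chruściel–Delay, Mém. SMF 94 (2003), §3): let `T : H → K` be a bounded linear
map of real Hilbert spaces (in *loc. cit.* `T = ψ Φ P*` acting on the multipliers `(Y, N)`)
satisfying the **coercivity estimate** `‖u‖ ≤ C ‖T u‖` (their inequality (3.4), the analytic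
content of "no KIDs"). Then

* `isCoercive_inner_adjoint_comp` — the form `⟨T†T u, v⟩ = ⟨Tu, Tv⟩` is coercive;
* `exists_adjoint_comp_self_equiv` — `L = T† T` is an isomorphism of `H` (Lax–Milgram; this is
  the operator `L_{φ,ψ} = ψ⁻²PΦψ²ΦP*` of Thm. 3.6 in the abstract);
* `exists_rightInverse_adjoint` — `R = T L⁻¹` is a continuous right inverse of `T† : K → H`
  with values in `range T` (the solutions "of the form `ψ²Φ²P*(Y,N)`" of Thm. 3.9);
* `exists_contDiffOn_family_of_adjoint_estimate` — combined with the implicit-function step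
  `Literature.Analysis.Calculus.exists_contDiffOn_family_of_rightInverse`: a `C^∞` map
  `Φ : K → H` near `δ₀` whose linearisation `DΦ(δ₀) = T†` satisfies the estimate admits, for
  every finite family of kernel vectors `v_j ∈ ker DΦ(δ₀)`, a `C^∞` finite-parameter family in
  the level set `{Φ = Φ δ₀}` through `δ₀` with tangents `v_j` (the shape of Cor. 5.11).

Everything is proved; no named facts.

## References

* P. T. Chruściel, E. Delay, Mém. Soc. Math. Fr. 94 (2003), Thm. 3.6, Thm. 3.9, Cor. 5.11.
  [ChruscielDelay2003]
* P. D. Lax, A. N. Milgram, *Parabolic equations*, Ann. Math. Stud. 33 (1954) (Mathlib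
  `IsCoercive.continuousLinearEquivOfBilin`).
-/

noncomputable section

open Set Function Filter Metric
open scoped Topology ContDiff InnerProductSpace InnerProduct

namespace Literature.Analysis.OperatorTheory

variable {H : Type*} [NormedAddCommGroup H] [InnerProductSpace ℝ H] [CompleteSpace H]
  {K : Type*} [NormedAddCommGroup K] [InnerProductSpace ℝ K] [CompleteSpace K]

open ContinuousLinearMap in
/-- The bilinear form `(u, v) ↦ ⟨T† T u, v⟩ = ⟨T u, T v⟩` is coercive when `‖u‖ ≤ C ‖T u‖`.
[cite: ChruscielDelay2003, Thm. 3.6] -/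
theorem isCoercive_inner_adjoint_comp (T : H →L[ℝ] K) {C : ℝ} (hC : 0 < C)
    (hT : ∀ u, ‖u‖ ≤ C * ‖T u‖) :
    IsCoercive ((innerSL ℝ (E := H)).comp ((T†).comp T)) := by
  refine ⟨(C ^ 2)⁻¹, by positivity, fun u ↦ ?_⟩
  have h1 : (innerSL ℝ (E := H)).comp ((T†).comp T) u u = ‖T u‖ ^ 2 := by
    simp only [coe_comp, comp_apply, innerSL_apply_apply]
    rw [adjoint_inner_left, real_inner_self_eq_norm_sq]
  rw [h1]
  have h2 : ‖u‖ ^ 2 ≤ C ^ 2 * ‖T u‖ ^ 2 := by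
    calc ‖u‖ ^ 2 ≤ (C * ‖T u‖) ^ 2 := pow_le_pow_left₀ (norm_nonneg _) (hT u) 2
      _ = C ^ 2 * ‖T u‖ ^ 2 := by ring
  have hC2 : 0 < C ^ 2 := by positivity
  calc (C ^ 2)⁻¹ * ‖u‖ * ‖u‖ = (C ^ 2)⁻¹ * ‖u‖ ^ 2 := by ring
    _ ≤ (C ^ 2)⁻¹ * (C ^ 2 * ‖T u‖ ^ 2) := by gcongr
    _ = ‖T u‖ ^ 2 := by field_simp

open ContinuousLinearMap in
/-- **`L = T† T` is an isomorphism** under the coercivity estimate (Lax–Milgram).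
[cite: ChruscielDelay2003, Thm. 3.6] -/
theorem exists_adjoint_comp_self_equiv (T : H →L[ℝ] K) {C : ℝ} (hC : 0 < C)
    (hT : ∀ u, ‖u‖ ≤ C * ‖T u‖) :
    ∃ A : H ≃L[ℝ] H, (A : H →L[ℝ] H) = (T†).comp T := by
  have hco := isCoercive_inner_adjoint_comp T hC hT
  refine ⟨hco.continuousLinearEquivOfBilin, ?_⟩
  ext v
  refine ext_inner_right ℝ fun w ↦ ?_
  rw [ContinuousLinearEquiv.coe_coe, hco.continuousLinearEquivOfBilin_apply]
  simp only [coe_comp, comp_apply, innerSL_apply_apply]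

open ContinuousLinearMap in
/-- **A continuous right inverse of `T†` with values in `range T`** under the coercivity estimate:
`R = T (T†T)⁻¹`. [cite: ChruscielDelay2003, Thm. 3.9] -/
theorem exists_rightInverse_adjoint (T : H →L[ℝ] K) {C : ℝ} (hC : 0 < C)
    (hT : ∀ u, ‖u‖ ≤ C * ‖T u‖) :
    ∃ R : H →L[ℝ] K, (T†).comp R = ContinuousLinearMap.id ℝ H ∧ ∀ f, R f ∈ range T := by
  obtain ⟨A, hA⟩ := exists_adjoint_comp_self_equiv T hC hT
  refine ⟨T.comp (A.symm : H →L[ℝ] H), ?_, fun f ↦ ⟨_, rfl⟩⟩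
  ext f
  have h : (T†) (T (A.symm f)) = ((T†).comp T) (A.symm f) := rfl
  simp only [coe_comp, comp_apply, coe_id', id_eq, ContinuousLinearEquiv.coe_coe]
  rw [h, ← hA, ContinuousLinearEquiv.coe_coe, ContinuousLinearEquiv.apply_symm_apply]

open ContinuousLinearMap in
/-- **Smooth finite-parameter families in a level set from the adjoint estimate** (the shape of
Chruściel–Delay 2003, Cor. 5.11): if `Φ : K → H` is `C^∞` on an open set `U ∋ δ₀`, its
linearisation at `δ₀` is the adjoint `T†` of an operator with `‖u‖ ≤ C‖Tu‖`, and
`v₁, …, v_k ∈ ker DΦ(δ₀)`, then there is a `C^∞` family `c ↦ δ(c)`, `c ∈ B(0,r) ⊆ ℝᵏ`, in `U`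
with `Φ(δ(c)) = Φ(δ₀)`, `δ(0) = δ₀`, `∂_{c_j} δ(0) = v_j`.
[cite: ChruscielDelay2003, Cor. 5.11] -/
theorem exists_contDiffOn_family_of_adjoint_estimate {Φ : K → H} {U : Set K} (hU : IsOpen U)
    (hΦ : ContDiffOn ℝ ∞ Φ U) {δ₀ : K} (hδ₀ : δ₀ ∈ U) (T : H →L[ℝ] K)
    (hDΦ : fderiv ℝ Φ δ₀ = T†) {C : ℝ} (hC : 0 < C) (hT : ∀ u, ‖u‖ ≤ C * ‖T u‖) {k : ℕ}
    (v : Fin k → K) (hv : ∀ j, fderiv ℝ Φ δ₀ (v j) = 0) :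
    ∃ (r : ℝ) (δ : EuclideanSpace ℝ (Fin k) → K), 0 < r ∧ ContDiffOn ℝ ∞ δ (ball 0 r) ∧
      δ 0 = δ₀ ∧ (∀ c ∈ ball (0 : EuclideanSpace ℝ (Fin k)) r, δ c ∈ U ∧ Φ (δ c) = Φ δ₀) ∧
      ∀ j, deriv (fun s : ℝ ↦ δ (EuclideanSpace.single j s)) 0 = v j := by
  obtain ⟨R, hR, -⟩ := exists_rightInverse_adjoint T hC hT
  have hR' : (fderiv ℝ Φ δ₀).comp R = ContinuousLinearMap.id ℝ H := by rw [hDΦ, hR]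
  exact Literature.Analysis.Calculus.exists_contDiffOn_family_of_rightInverse hU hΦ hδ₀ R hR' v hv

end Literature.Analysis.OperatorTheory

end
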